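import Mathlib
import HarnessLib
import Literature.Probability.Percolation.MinOpenCut
import Literature.Probability.Percolation.MinOpenCutMenger
import Literature.Probability.Percolation.SharpnessDCTProofs
import Literature.Probability.Percolation.LatticeSymmetry
import Literature.Probability.Percolation.SitePaths
import Literature.Probability.Percolation.PlanarDuality
import Literature.Probability.Percolation.CriticalContinuity

/-!
# `stub_floor` of line `Sketch` (crux `BudgetTightness`, stmt-CriticalPhenomena-5248):
# the universal floor `c · L² ≤ h² · E_{p_c}[S(L, h)]` for `h ≥ 1`, `L ≥ 18 h`

`S(L, h) = minOpenCutIn Q(L,h) bottom top` is the bottom-to-top min-cut budget of the slab piece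
`Q(L, h) = [0, L]² × [0, h] ⊆ ℤ³` (`MinOpenCut.lean`). Assuming that critical aspect-2 annuli
`box m → ∂ⁱⁿ box 2m` are crossed inside `box 2m` with probability `≥ ε` for every `m ≥ 1`, we
get `(ε / 1944) · L² ≤ h² · E_{p_c}[S(L, h)]` for `h ≥ 1`, `L ≥ 18 h`. SIX LIDS (`routing`): an
open crossing of the annulus `box (h+1) → ∂ⁱⁿ box (2h+2)` crosses one of the six lids
`Φ_{i,s}(Q(4h+4, h))` bottom-to-top (`Φ_{i,s}` lattice automorphisms), so by a union bound and
invariance of `P_p`, `P(Q(4h+4,h) crossed) ≥ ε / 6` (`real_annulusCrossing_le`). BLOCKS: the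
`k²` translates `Q(4h+4,h) + ((4h+5)a, (4h+5)b, 0)`, `a, b < k = (L+1)/(4h+5)`, are pairwise
disjoint full-height sub-pieces of `Q(L, h)`, so `Σ_{a,b} 𝟙{block crossed} ≤ Σ_{a,b} S(block)
≤ S(L, h)` (`sum_minOpenCutIn_le_of_subset`); integrating (translation invariance),
`k² ε / 6 ≤ E[S(L, h)]` (`sq_mul_real_le_integral`). ARITHMETIC: `L + 1 < (4h+5)(k+1) ≤ 18 h k`.
-/

noncomputable section

namespace Summit.CriticalPhenomena.PercolationContinuityZ3.Theorems.BudgetTightness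

open MeasureTheory ProbabilityTheory
open Literature.Probability.Percolation Literature.Probability.LatticeModels

namespace StubFloor

-- adapted from Theorems/PercBudgetLadderBudgetTightnessStubSuperadditive.lean
/-- **Superadditivity of the budget over disjoint sub-regions** `S i ⊆ S'` with `A i ⊆ A'`,
`B i ⊆ B'`: `∑_{i ∈ s} MinCut_{S i}(A i, B i)(ω) ≤ MinCut_{S'}(A', B')(ω)` (restrict an
optimal open cutset of the big region to the pairs inside each `S i`). -/
theorem sum_minOpenCutIn_le_of_subset {V ι : Type*} {s : Finset ι} {S A B : ι → Set V}
    {S' A' B' : Set V} {ω : BondConfig V} (hsub : ∀ i ∈ s, S i ⊆ S' ∧ A i ⊆ A' ∧ B i ⊆ B')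
    (hdisj : ∀ i ∈ s, ∀ j ∈ s, i ≠ j → Disjoint (S i) (S j)) :
    ∑ i ∈ s, minOpenCutIn (S i) (A i) (B i) ω ≤ minOpenCutIn S' A' B' ω := by
  classical
  by_cases htop : minOpenCutIn S' A' B' ω = ⊤
  · rw [htop]; exact le_top
  obtain ⟨T, hT, hcard⟩ := exists_eq_minOpenCutIn htop
  have hcut : ∀ i ∈ s, IsOpenCutsetIn (S i) (A i) (B i) ω ↑(T.filter (· ∈ (S i).sym2)) := by
    intro i hi
    rw [Finset.coe_filter]
    exact isOpenCutsetIn_inter_sym2_iff.2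
      ((hT.anti_set (hsub i hi).1).anti (hsub i hi).2.1 (hsub i hi).2.2)
  have hdisjT : (↑s : Set ι).PairwiseDisjoint (fun i => T.filter (· ∈ (S i).sym2)) := by
    intro i hi j hj hij
    rw [Function.onFun, Finset.disjoint_filter]
    intro e _ hei hej
    induction e using Sym2.ind with
    | h u v =>
      exact Set.disjoint_left.1 (hdisj i hi j hj hij) (Set.mk_mem_sym2_iff.1 hei).1
        (Set.mk_mem_sym2_iff.1 hej).1
  calc ∑ i ∈ s, minOpenCutIn (S i) (A i) (B i) ω
      ≤ ∑ i ∈ s, ((T.filter (· ∈ (S i).sym2)).card : ℕ∞) :=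
        Finset.sum_le_sum fun i hi => minOpenCutIn_le_card (hcut i hi)
    _ = ((s.biUnion fun i => T.filter (· ∈ (S i).sym2)).card : ℕ) := by
        rw [Finset.card_biUnion hdisjT, Nat.cast_sum]
    _ ≤ (T.card : ℕ∞) := by
        exact_mod_cast Finset.card_le_card
          (Finset.biUnion_subset.2 fun i _ => Finset.filter_subset _ _)
    _ = _ := hcard

-- adapted from Theorems/PercBudgetLadderBudgetTightnessStubSixLids.lean
/-- **Integrability of the real-valued budget of a finite region of `ℤ³` under `P_p`**: it is
measurable (level sets `measurableSet_setOf_minOpenCutIn_le`) and bounded by `#pairs(S)` (if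
the budget is finite, `A ∩ B ∩ S = ∅` and closing all pairs inside `S` is an open cutset). -/
theorem integrable_toNat_minOpenCutIn {S : Set (Site 3)} (hS : S.Finite) (A B : Set (Site 3))
    (p : unitInterval) :
    Integrable (fun ω => ((minOpenCutIn S A B ω).toNat : ℝ)) (bondPercolation (zdGraph 3) p) := by
  have hle := measurableSet_setOf_minOpenCutIn_le hS A B
  have hmeas : Measurable (minOpenCutIn S A B) := ENat.measurable_iff.2 fun n => by
    cases n with
    | zero => convert hle 0 using 1; ext ω; simp
    | succ n =>
      convert (hle (n + 1)).diff (hle n) using 1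
      ext ω
      simp only [Set.mem_preimage, Set.mem_singleton_iff, Set.mem_sdiff, Set.mem_setOf_eq,
        not_le, Nat.cast_succ, le_antisymm_iff, ENat.coe_add_one_le_iff]
  refine Integrable.of_bound ((measurable_of_countable fun j : ℕ => (j : ℝ)).comp
    ((measurable_of_countable ENat.toNat).comp hmeas)).aestronglyMeasurable
    (hS.toFinset.sym2.card : ℝ) (Filter.Eventually.of_forall fun ω => ?_)
  rw [Real.norm_eq_abs, abs_of_nonneg (Nat.cast_nonneg _)]
  by_cases htop : minOpenCutIn S A B ω = ⊤
  · simp [htop]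
  refine Nat.cast_le.2 (ENat.toNat_le_of_le_coe (minOpenCutIn_le_card fun x hx y hy hω => ?_))
  obtain ⟨hxS, hyS, ⟨q⟩⟩ := hω
  cases q with
  | nil => exact htop ((minOpenCutIn_eq_top_iff_of_finite hS A B ω).2 ⟨x, hxS, hx, hy⟩)
  | cons hadj _ =>
    rw [SimpleGraph.induce_adj, openGraph_adj] at hadj
    refine hadj.1.2 ?_
    rw [Finset.mem_coe, Finset.mk_mem_sym2_iff, Set.Finite.mem_toFinset, Set.Finite.mem_toFinset]
    exact ⟨hxS, Subtype.prop _⟩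

/-- Membership in a box `Set.Icc ![a₀, a₁, a₂] ![b₀, b₁, b₂]` of `ℤ³`, coordinatewise. -/
theorem mem_Icc3 {a0 a1 a2 b0 b1 b2 : ℤ} {w : Site 3} :
    w ∈ Set.Icc (![a0, a1, a2] : Site 3) ![b0, b1, b2] ↔
      a0 ≤ w 0 ∧ a1 ≤ w 1 ∧ a2 ≤ w 2 ∧ w 0 ≤ b0 ∧ w 1 ≤ b1 ∧ w 2 ≤ b2 := by
  simp only [Set.mem_Icc, Pi.le_def, Fin.forall_fin_succ, IsEmpty.forall_iff, and_true, and_assoc,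
    Matrix.cons_val_zero, Matrix.cons_val_succ, Fin.succ_zero_eq_one, Fin.succ_one_eq_two]

/-- For `h ≥ 1` bottom and top of `Q(L, h)` are disjoint, so the budget `S(L, h)` is finite. -/
theorem piece_ne_top {h : ℕ} (hh : 1 ≤ h) (L : ℕ) (ω : BondConfig (Site 3)) :
    minOpenCutIn (Set.Icc (![0, 0, 0] : Site 3) ![(L : ℤ), (L : ℤ), (h : ℤ)])
      (Set.Icc (![0, 0, 0] : Site 3) ![(L : ℤ), (L : ℤ), 0])
      (Set.Icc (![0, 0, (h : ℤ)] : Site 3) ![(L : ℤ), (L : ℤ), (h : ℤ)]) ω ≠ ⊤ := by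
  rw [Ne, minOpenCutIn_eq_top_iff_of_finite (Set.finite_Icc _ _)]
  rintro ⟨a, -, ha, ha'⟩
  rw [mem_Icc3] at ha ha'
  omega

-- the geometry of the lids is adapted from Theorems/PercBudgetLadderBudgetTightnessStubSixLids.lean
/-- Multiplication by a sign preserves symmetric intervals. -/
theorem units_mul_mem {s : ℤˣ} {t M : ℤ} (h : -M ≤ t ∧ t ≤ M) :
    -M ≤ (s : ℤ) * t ∧ (s : ℤ) * t ≤ M := by
  rcases Int.units_eq_one_or s with rfl | rfl
  · simp only [Units.val_one, one_mul]; omega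
  · simp only [Units.val_neg, Units.val_one, neg_mul, one_mul]; omega

/-- Along a lattice step a signed coordinate increases by at most one. -/
theorem units_mul_le_add_one_of_adj {s : ℤˣ} {a b : Site 3} (hab : (zdGraph 3).Adj a b)
    (i : Fin 3) : (s : ℤ) * b i ≤ (s : ℤ) * a i + 1 := by
  have h := DCT16.abs_sub_le_one_of_adj hab i
  rw [abs_le] at h
  rcases Int.units_eq_one_or s with rfl | rfl
  · simp only [Units.val_one, one_mul]; omega
  · simp only [Units.val_neg, Units.val_one, neg_mul, one_mul]; omega

/-- **The lid in coordinates.** If `(φ⁻¹ v)_j = s v_{π j} - w_j`, `π = swap 2 i`,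
`w = (-(2h+2), -(2h+2), h+2)`, then `v ∈ φ([0, 4h+4]² × [a, b])` for `v ∈ box (2h+2)` with
`a + h + 2 ≤ s v_i ≤ b + h + 2`. -/
theorem symm_mem_Icc {h : ℕ} {φ : zdGraph 3 ≃g zdGraph 3} {i : Fin 3} {s : ℤˣ}
    (hφ : ∀ (v : Site 3) (j : Fin 3), φ.symm v j = (s : ℤ) * v (Equiv.swap (2 : Fin 3) i j) -
      (![-(2 * (h : ℤ) + 2), -(2 * (h : ℤ) + 2), (h : ℤ) + 2] : Site 3) j)
    {v : Site 3} (hv : v ∈ box 3 (2 * (h + 1))) {a b : ℤ} (ha : a + ((h : ℤ) + 2) ≤ (s : ℤ) * v i)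
    (hb : (s : ℤ) * v i ≤ 2 * (h : ℤ) + 2 → (s : ℤ) * v i ≤ b + ((h : ℤ) + 2)) :
    v ∈ φ '' Set.Icc (![0, 0, a] : Site 3) ![((4 * h + 4 : ℕ) : ℤ), ((4 * h + 4 : ℕ) : ℤ), b] := by
  have hε : ∀ k, -(2 * (h : ℤ) + 2) ≤ (s : ℤ) * v k ∧ (s : ℤ) * v k ≤ 2 * (h : ℤ) + 2 :=
    fun k => by have h1 := units_mul_mem (s := s) ((mem_box.1 hv) k); push_cast at h1; omega
  have h0 := hε (Equiv.swap (2 : Fin 3) i 0)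
  have h1 := hε (Equiv.swap (2 : Fin 3) i 1)
  have h2 := hb (hε i).2
  refine ⟨φ.symm v, ?_, RelIso.apply_symm_apply φ v⟩
  rw [mem_Icc3]
  simp only [hφ, Equiv.swap_apply_left, Matrix.cons_val]
  push_cast
  omega

/-- **Six-lid routing** (lattice configurations `ω ⊆ E(ℤ³)`): if the inverses of the six maps
`φ (i, s)` are `(φ (i,s)⁻¹ v)_j = s v_{π j} - w_j`, `π = swap 2 i`, `w = (-(2h+2), -(2h+2), h+2)`,
every open path inside `box (2h+2)` from `box (h+1)` to `∂ⁱⁿ box (2h+2)` contains an open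
bottom-to-top crossing of one of the six lids `φ q '' Q(4h+4, h)` (last visit to `{s x_i ≤ h+1}`). -/
theorem routing {h : ℕ} {φ : Fin 3 × ℤˣ → zdGraph 3 ≃g zdGraph 3}
    (hφ : ∀ (q : Fin 3 × ℤˣ) (v : Site 3) (j : Fin 3),
      (φ q).symm v j = (q.2 : ℤ) * v (Equiv.swap (2 : Fin 3) q.1 j) -
        (![-(2 * (h : ℤ) + 2), -(2 * (h : ℤ) + 2), (h : ℤ) + 2] : Site 3) j)
    {ω : BondConfig (Site 3)} (hω : ω ⊆ (zdGraph 3).edgeSet) {x y : Site 3}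
    (hx : x ∈ box 3 (h + 1)) (hy : y ∈ innerBoundary (zdGraph 3) (box 3 (2 * (h + 1))))
    (hxy : ω ∈ openConnIn ((box 3 (2 * (h + 1)) : Finset (Site 3)) : Set (Site 3)) x y) :
    ω ∈ ⋃ q : Fin 3 × ℤˣ, openCrossing
      (φ q '' Set.Icc (![0, 0, 0] : Site 3)
        ![((4 * h + 4 : ℕ) : ℤ), ((4 * h + 4 : ℕ) : ℤ), (h : ℤ)])
      (φ q '' Set.Icc (![0, 0, 0] : Site 3) ![((4 * h + 4 : ℕ) : ℤ), ((4 * h + 4 : ℕ) : ℤ), 0])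
      (φ q '' Set.Icc (![0, 0, (h : ℤ)] : Site 3)
        ![((4 * h + 4 : ℕ) : ℤ), ((4 * h + 4 : ℕ) : ℤ), (h : ℤ)]) := by
  have hP := DCT16.pathIn_of_mem_openConnIn hxy
  obtain ⟨q, hs⟩ : ∃ q : Fin 3 × ℤˣ, (q.2 : ℤ) * y q.1 = 2 * (h : ℤ) + 2 := by
    obtain ⟨i, hi | hi⟩ := exists_eq_of_mem_innerBoundary_box hy
    · exact ⟨(i, 1), show ((1 : ℤˣ) : ℤ) * y i = _ by rw [hi]; push_cast; ring⟩
    · exact ⟨(i, -1), show ((-1 : ℤˣ) : ℤ) * y i = _ by rw [hi]; push_cast; ring⟩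
  have hxC : x ∈ {v : Site 3 | (q.2 : ℤ) * v q.1 ≤ (h : ℤ) + 1} := by
    have h2 := units_mul_mem (s := q.2) ((mem_box.1 hx) q.1); push_cast at h2; exact h2.2
  have hyC : y ∉ {v : Site 3 | (q.2 : ℤ) * v q.1 ≤ (h : ℤ) + 1} :=
    fun h' : (q.2 : ℤ) * y q.1 ≤ (h : ℤ) + 1 => by omega
  obtain ⟨a, b, haC, -, hbC, hab, hPb⟩ := hP.last_exit hxC hyC
  have hbi : (q.2 : ℤ) * b q.1 = (h : ℤ) + 2 := by
    have h1 := units_mul_le_add_one_of_adj (s := q.2) (DCT16.adj_of_openGraph_adj hω hab) q.1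
    have h3 : (q.2 : ℤ) * a q.1 ≤ (h : ℤ) + 1 := haC
    have h4 : ¬ ((q.2 : ℤ) * b q.1 ≤ (h : ℤ) + 1) := hbC
    omega
  refine Set.mem_iUnion.2 ⟨q, b, symm_mem_Icc (hφ q) hPb.left_mem.1 (by omega) (fun _ => by omega),
    y, symm_mem_Icc (hφ q) hP.right_mem (by omega) (fun _ => by omega),
    DCT16.mem_openConnIn_of_pathIn (hPb.mono fun v hv => ?_)⟩
  have h4 : ¬ ((q.2 : ℤ) * v q.1 ≤ (h : ℤ) + 1) := hv.2
  exact symm_mem_Icc (hφ q) hv.1 (by omega) (fun h2 => by omega)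

/-- **Six-lid union bound** `P_p(box (h+1) → ∂ⁱⁿ box (2h+2) crossed inside box (2h+2))
≤ 6 · P_p(Q(4h+4, h) crossed bottom → top)`: the lid maps `Φ_{i,s} = σ_{i,s} ∘ (· + w_h)`
(`zdShiftIso`, `zdSignedPermIso`), `routing`, a union bound, and `bondPercolation_real_image`. -/
theorem real_annulusCrossing_le (p : unitInterval) (h : ℕ) :
    (bondPercolation (zdGraph 3) p).real {ω | ∃ x ∈ box 3 (h + 1),
        ∃ y ∈ innerBoundary (zdGraph 3) (box 3 (2 * (h + 1))),
          ω ∈ openConnIn (↑(box 3 (2 * (h + 1))) : Set (Site 3)) x y} ≤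
      6 * (bondPercolation (zdGraph 3) p).real (openCrossing
        (Set.Icc (![0, 0, 0] : Site 3) ![((4 * h + 4 : ℕ) : ℤ), ((4 * h + 4 : ℕ) : ℤ), (h : ℤ)])
        (Set.Icc (![0, 0, 0] : Site 3) ![((4 * h + 4 : ℕ) : ℤ), ((4 * h + 4 : ℕ) : ℤ), 0])
        (Set.Icc (![0, 0, (h : ℤ)] : Site 3)
          ![((4 * h + 4 : ℕ) : ℤ), ((4 * h + 4 : ℕ) : ℤ), (h : ℤ)])) := by
  set w : Site 3 := ![-(2 * (h : ℤ) + 2), -(2 * (h : ℤ) + 2), (h : ℤ) + 2]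
  obtain ⟨φ, hφ⟩ : ∃ φ : Fin 3 × ℤˣ → zdGraph 3 ≃g zdGraph 3,
      ∀ (q : Fin 3 × ℤˣ) (v : Site 3) (j : Fin 3),
        (φ q).symm v j = (q.2 : ℤ) * v (Equiv.swap (2 : Fin 3) q.1 j) - w j :=
    ⟨fun q => (zdShiftIso w).trans (zdSignedPermIso (Equiv.swap (2 : Fin 3) q.1) fun _ => q.2),
      fun q v j => by
        show ((zdShiftIso w).trans (zdSignedPermIso _ _)).symm v j = _
        rw [RelIso.symm_trans_apply]
        change (Site.shift w).symm
          ((Site.signedPerm (Equiv.swap (2 : Fin 3) q.1) fun _ => q.2).symm v) j = _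
        rw [Site.shift_symm_apply, Pi.sub_apply, Site.signedPerm_symm_apply]⟩
  set μ := bondPercolation (zdGraph 3) p
  set Q := Set.Icc (![0, 0, 0] : Site 3)
    ![((4 * h + 4 : ℕ) : ℤ), ((4 * h + 4 : ℕ) : ℤ), (h : ℤ)]
  set B := Set.Icc (![0, 0, 0] : Site 3) ![((4 * h + 4 : ℕ) : ℤ), ((4 * h + 4 : ℕ) : ℤ), (0 : ℤ)]
  set T := Set.Icc (![0, 0, (h : ℤ)] : Site 3)
    ![((4 * h + 4 : ℕ) : ℤ), ((4 * h + 4 : ℕ) : ℤ), (h : ℤ)]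
  calc _ ≤ μ.real (⋃ q, openCrossing (φ q '' Q) (φ q '' B) (φ q '' T)) := by
        exact DCT16.real_mono_of_forall_subset_edgeSet _ _ fun ω hω ⟨x, hx, y, hy, hxy⟩ =>
          routing hφ hω hx hy hxy
    _ ≤ ∑ q, μ.real (openCrossing (φ q '' Q) (φ q '' B) (φ q '' T)) :=
        measureReal_iUnion_fintype_le _
    _ = ∑ _q : Fin 3 × ℤˣ, μ.real (openCrossing Q B T) :=
        Finset.sum_congr rfl fun q _ => bondPercolation_real_image (φ q) p _ _ _
    _ = _ := by
        rw [Finset.sum_const, Finset.card_univ, nsmul_eq_mul]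
        norm_num [Fintype.card_prod, Fintype.card_units_int]

/-- Membership in the lateral translate `(P, R, 0) + [0, M]² × [lo, hi]`, coordinatewise. -/
theorem mem_shift_Icc_iff {P R : ℕ} {lo hi M : ℤ} {v : Site 3} :
    v ∈ (· + (![(P : ℤ), (R : ℤ), 0] : Site 3)) '' Set.Icc (![0, 0, lo] : Site 3) ![M, M, hi] ↔
      ((P : ℤ) ≤ v 0 ∧ v 0 ≤ P + M) ∧ ((R : ℤ) ≤ v 1 ∧ v 1 ≤ R + M) ∧
        (lo ≤ v 2 ∧ v 2 ≤ hi) := by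
  rw [Set.image_add_right, Set.mem_preimage, mem_Icc3]
  simp only [Pi.add_apply, Pi.neg_apply, Matrix.cons_val]
  omega

/-- A translate `(P, R, 0) + [0, M]² × [lo, hi]` with `P + M, R + M ≤ L` lies in
`[0, L]² × [lo, hi]`. -/
theorem shift_Icc_subset {P R M L : ℕ} (hP : P + M ≤ L) (hR : R + M ≤ L) (lo hi : ℤ) :
    (· + (![(P : ℤ), (R : ℤ), 0] : Site 3)) '' Set.Icc (![0, 0, lo] : Site 3)
      ![(M : ℤ), (M : ℤ), hi] ⊆ Set.Icc (![0, 0, lo] : Site 3) ![(L : ℤ), (L : ℤ), hi] :=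
    fun v hv => by
  have h1 := mem_shift_Icc_iff.1 hv
  rw [mem_Icc3]
  omega

/-- Blocks `[N a, N a + M]`, `[N a', N a' + M]` of period `N > M` that meet have equal index. -/
theorem eq_of_blocks_meet {N M a a' : ℕ} (hM : M < N) {z : ℤ} (h1 : ((N * a : ℕ) : ℤ) ≤ z)
    (h2 : z ≤ ((N * a : ℕ) : ℤ) + M) (h3 : ((N * a' : ℕ) : ℤ) ≤ z)
    (h4 : z ≤ ((N * a' : ℕ) : ℤ) + M) : a = a' := by
  push_cast at h1 h2 h3 h4
  have hMN : (M : ℤ) < N := by exact_mod_cast hM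
  have key1 : (N : ℤ) * a < N * ((a' : ℤ) + 1) := by linarith
  have key2 : (N : ℤ) * a' < N * ((a : ℤ) + 1) := by linarith
  have c1 := lt_of_mul_lt_mul_left key1 (by positivity)
  have c2 := lt_of_mul_lt_mul_left key2 (by positivity)
  omega

/-- **Blocks.** For `h ≥ 1`, `(4h+5) k ≤ L + 1`: `k² · P_p(Q(4h+4, h) crossed) ≤ E_p[S(L, h)]`.
Pointwise, `Σ_{a,b<k} 𝟙{block (a,b) crossed}(ω) ≤ Σ_{a,b<k} S(block (a,b))(ω) ≤ S(L, h)(ω)`: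
the blocks `Q(4h+4, h) + ((4h+5)a, (4h+5)b, 0)` are pairwise disjoint full-height sub-pieces of
`Q(L, h)` (`sum_minOpenCutIn_le_of_subset`) and a crossed block has budget `≥ 1`
(`minOpenCutIn_eq_zero_iff`); then integrate (all block crossing events are equiprobable,
`real_openCrossing_shift`). -/
theorem sq_mul_real_le_integral (p : unitInterval) {h L k : ℕ} (hh : 1 ≤ h)
    (hk : (4 * h + 5) * k ≤ L + 1) :
    (k : ℝ) ^ 2 * (bondPercolation (zdGraph 3) p).real (openCrossing
        (Set.Icc (![0, 0, 0] : Site 3) ![((4 * h + 4 : ℕ) : ℤ), ((4 * h + 4 : ℕ) : ℤ), (h : ℤ)])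
        (Set.Icc (![0, 0, 0] : Site 3) ![((4 * h + 4 : ℕ) : ℤ), ((4 * h + 4 : ℕ) : ℤ), 0])
        (Set.Icc (![0, 0, (h : ℤ)] : Site 3)
          ![((4 * h + 4 : ℕ) : ℤ), ((4 * h + 4 : ℕ) : ℤ), (h : ℤ)])) ≤
      ∫ ω, ((minOpenCutIn (Set.Icc (![0, 0, 0] : Site 3) ![(L : ℤ), (L : ℤ), (h : ℤ)])
        (Set.Icc (![0, 0, 0] : Site 3) ![(L : ℤ), (L : ℤ), 0])
        (Set.Icc (![0, 0, (h : ℤ)] : Site 3) ![(L : ℤ), (L : ℤ), (h : ℤ)]) ω).toNat : ℝ)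
        ∂(bondPercolation (zdGraph 3) p) := by
  set μ := bondPercolation (zdGraph 3) p
  set Q₀ := Set.Icc (![0, 0, 0] : Site 3)
    ![((4 * h + 4 : ℕ) : ℤ), ((4 * h + 4 : ℕ) : ℤ), (h : ℤ)]
  set B₀ := Set.Icc (![0, 0, 0] : Site 3)
    ![((4 * h + 4 : ℕ) : ℤ), ((4 * h + 4 : ℕ) : ℤ), (0 : ℤ)]
  set T₀ := Set.Icc (![0, 0, (h : ℤ)] : Site 3)
    ![((4 * h + 4 : ℕ) : ℤ), ((4 * h + 4 : ℕ) : ℤ), (h : ℤ)]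
  set Q := Set.Icc (![0, 0, 0] : Site 3) ![(L : ℤ), (L : ℤ), (h : ℤ)]
  set B := Set.Icc (![0, 0, 0] : Site 3) ![(L : ℤ), (L : ℤ), (0 : ℤ)]
  set T := Set.Icc (![0, 0, (h : ℤ)] : Site 3) ![(L : ℤ), (L : ℤ), (h : ℤ)]
  set s := Finset.range k ×ˢ Finset.range k
  set sh : ℕ × ℕ → Site 3 := fun ab =>
    ![(((4 * h + 5) * ab.1 : ℕ) : ℤ), (((4 * h + 5) * ab.2 : ℕ) : ℤ), 0]
  set E : ℕ × ℕ → Set (BondConfig (Site 3)) := fun ab =>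
    openCrossing ((· + sh ab) '' Q₀) ((· + sh ab) '' B₀) ((· + sh ab) '' T₀)
  -- pointwise: `Σ_{ab ∈ s} 𝟙{E ab} ≤ S(L, h)`
  have hpt : ∀ ω, ∑ ab ∈ s, (E ab).indicator 1 ω ≤ ((minOpenCutIn Q B T ω).toNat : ℝ) := by
    intro ω
    have hblk : ∀ ab ∈ s,
        (4 * h + 5) * ab.1 + (4 * h + 4) ≤ L ∧ (4 * h + 5) * ab.2 + (4 * h + 4) ≤ L := by
      intro ab hab
      obtain ⟨ha, hb⟩ := Finset.mem_product.1 hab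
      have h1 : (4 * h + 5) * (ab.1 + 1) ≤ (4 * h + 5) * k :=
        Nat.mul_le_mul_left _ (Finset.mem_range.1 ha)
      have h2 : (4 * h + 5) * (ab.2 + 1) ≤ (4 * h + 5) * k :=
        Nat.mul_le_mul_left _ (Finset.mem_range.1 hb)
      rw [Nat.mul_succ] at h1 h2
      omega
    have hsum : ∑ ab ∈ s,
        minOpenCutIn ((· + sh ab) '' Q₀) ((· + sh ab) '' B₀) ((· + sh ab) '' T₀) ω ≤
          minOpenCutIn Q B T ω :=
      sum_minOpenCutIn_le_of_subset (fun ab hab => ⟨shift_Icc_subset (hblk ab hab).1 (hblk ab hab).2 _ _,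
          shift_Icc_subset (hblk ab hab).1 (hblk ab hab).2 _ _,
          shift_Icc_subset (hblk ab hab).1 (hblk ab hab).2 _ _⟩)
        (fun ab _ ab' _ hne => Set.disjoint_left.2 fun v hv hv' => hne <| by
          have h1 := mem_shift_Icc_iff.1 hv
          have h2 := mem_shift_Icc_iff.1 hv'
          exact Prod.ext (eq_of_blocks_meet (by omega) h1.1.1 h1.1.2 h2.1.1 h2.1.2)
            (eq_of_blocks_meet (by omega) h1.2.1.1 h1.2.1.2 h2.2.1.1 h2.2.1.2))
    have htop : minOpenCutIn Q B T ω ≠ ⊤ := piece_ne_top hh L ω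
    have hM : ∀ ab ∈ s,
        minOpenCutIn ((· + sh ab) '' Q₀) ((· + sh ab) '' B₀) ((· + sh ab) '' T₀) ω ≠ ⊤ :=
      fun ab hab => ne_top_of_le_ne_top htop
        ((Finset.single_le_sum_of_canonicallyOrdered hab).trans hsum)
    have h1 := ENat.toNat_le_toNat hsum htop
    rw [ENat.toNat_sum hM, ← Nat.cast_le (α := ℝ), Nat.cast_sum] at h1
    refine (Finset.sum_le_sum fun ab hab => ?_).trans h1
    by_cases hω : ω ∈ E ab
    · rw [Set.indicator_of_mem hω, Pi.one_apply]
      obtain ⟨x, hx, y, hy, hxy⟩ := hω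
      exact_mod_cast Nat.one_le_iff_ne_zero.2 (ENat.toNat_pos
        (fun h0 => minOpenCutIn_eq_zero_iff.1 h0 x hx y hy hxy) (hM ab hab)).ne'
    · rw [Set.indicator_of_notMem hω]
      exact Nat.cast_nonneg _
  -- integrate
  have hQ₀ : Q₀.Finite := Set.finite_Icc _ _
  have hmeas : ∀ ab, MeasurableSet (E ab) := fun ab => by
    show MeasurableSet (openCrossing ((· + sh ab) '' Q₀) _ _)
    rw [← (hQ₀.image (· + sh ab)).coe_toFinset]
    exact measurableSet_openCrossing _ _ _
  have hint : ∀ ab ∈ s, Integrable (fun ω => (E ab).indicator 1 ω) μ :=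
    fun ab _ => (integrable_const (1 : ℝ)).indicator (hmeas ab)
  have hE : ∀ ab, μ.real (E ab) = μ.real (openCrossing Q₀ B₀ T₀) :=
    fun ab => real_openCrossing_shift p (sh ab) _ _ _
  calc (k : ℝ) ^ 2 * μ.real (openCrossing Q₀ B₀ T₀) = ∑ ab ∈ s, μ.real (E ab) := by
        rw [Finset.sum_congr rfl fun ab _ => hE ab, Finset.sum_const, Finset.card_product,
          Finset.card_range, nsmul_eq_mul, Nat.cast_mul, sq]
    _ = ∑ ab ∈ s, ∫ ω, (E ab).indicator 1 ω ∂μ :=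
        Finset.sum_congr rfl fun ab _ => (integral_indicator_one (hmeas ab)).symm
    _ = ∫ ω, ∑ ab ∈ s, (E ab).indicator 1 ω ∂μ := (integral_finsetSum s hint).symm
    _ ≤ ∫ ω, ((minOpenCutIn Q B T ω).toNat : ℝ) ∂μ :=
        integral_mono (integrable_finsetSum s hint)
          (integrable_toNat_minOpenCutIn (Set.finite_Icc _ _) _ _ _) hpt

end StubFloor

open StubFloor in
/-- **`stub_floor` (registered stub of line `Sketch`, crux stmt-CriticalPhenomena-5248): the
universal floor `c · L² ≤ h² · E_{p_c}[S(L, h)]`** for `h ≥ 1`, `L ≥ 18 h` (`c = ε / 1944`),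
given that critical aspect-2 annuli are crossed with probability `≥ ε` at every scale: six-lid
union bound `P_{p_c}(Q(4h+4, h) crossed) ≥ ε / 6` (`real_annulusCrossing_le`), block
superadditivity `E_{p_c}[S(L, h)] ≥ k² ε / 6`, `k = (L+1)/(4h+5)` (`sq_mul_real_le_integral`),
and `L < (4h+5)(k+1) ≤ 18 h k`. -/
theorem stub_floor :
    (∃ ε : ℝ, 0 < ε ∧ ∀ m : ℕ, 1 ≤ m →
      ε ≤ (bondPercolation (zdGraph 3) (criticalProbI 3)).real
        {ω | ∃ x ∈ box 3 m, ∃ y ∈ innerBoundary (zdGraph 3) (box 3 (2 * m)),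
          ω ∈ openConnIn (↑(box 3 (2 * m)) : Set (Site 3)) x y}) →
    ∃ c : ℝ, 0 < c ∧ ∀ h : ℕ, 1 ≤ h → ∀ L : ℕ, 18 * h ≤ L →
      c * (L : ℝ) ^ 2 ≤ (h : ℝ) ^ 2 * ∫ ω, ((minOpenCutIn
          (Set.Icc (![0, 0, 0] : Site 3) ![(L : ℤ), (L : ℤ), (h : ℤ)])
          (Set.Icc (![0, 0, 0] : Site 3) ![(L : ℤ), (L : ℤ), 0])
          (Set.Icc (![0, 0, (h : ℤ)] : Site 3) ![(L : ℤ), (L : ℤ), (h : ℤ)])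
          ω).toNat : ℝ) ∂(bondPercolation (zdGraph 3) (criticalProbI 3)) := by
  rintro ⟨ε, hε, hF⟩
  refine ⟨ε / 1944, by positivity, fun h hh L hL => ?_⟩
  -- six lids `ε ≤ 6 P(Q(4h+4, h) crossed)`; blocks `k² P(…) ≤ E[S(L, h)]`, `k = (L+1)/(4h+5)`
  have hP := (hF (h + 1) (by omega)).trans (real_annulusCrossing_le _ h)
  set k := (L + 1) / (4 * h + 5)
  have hI := sq_mul_real_le_integral (criticalProbI 3) hh (Nat.mul_div_le (L + 1) (4 * h + 5))
  -- arithmetic: `L < (4h+5)(k+1) ≤ 18 h k`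
  have hk2 : L + 1 < (4 * h + 5) * (k + 1) := Nat.lt_mul_div_succ (L + 1) (by omega)
  have hk3 : 1 ≤ k := (Nat.le_div_iff_mul_le (by omega)).2 (by omega)
  have e0 : (L : ℝ) + 1 < (4 * h + 5) * (k + 1) := by exact_mod_cast hk2
  have e1 : (1 : ℝ) ≤ h := by exact_mod_cast hh
  have e2 : (1 : ℝ) ≤ k := by exact_mod_cast hk3
  have hL18 : (L : ℝ) ≤ 18 * h * k := by nlinarith
  calc ε / 1944 * (L : ℝ) ^ 2 ≤ ε / 1944 * (18 * h * k) ^ 2 := by gcongr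
    _ = (h : ℝ) ^ 2 * ((k : ℝ) ^ 2 * (ε / 6)) := by ring
    _ ≤ _ := mul_le_mul_of_nonneg_left
        ((mul_le_mul_of_nonneg_left (by linarith) (sq_nonneg _)).trans hI) (sq_nonneg _)

end Summit.CriticalPhenomena.PercolationContinuityZ3.Theorems.BudgetTightness

end
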